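import Summits.QuantumFields.BalabanUV.T4Continuum.Support.ShellMeasureDuhamelHadamardSUN
import Mathlib.Analysis.SpecialFunctions.Integrals.Basic
import Mathlib.Analysis.InnerProductSpace.NormDet

/-!
# `T4Continuum.ShellMeasureExpDuhamelDetSUN` — THE DETERMINANT OF THE DUHAMEL CHART OPERATOR OF `SU(N)`:
# `det T_v = ∏_{i<j} sinc²((θ_j−θ_i)/2)` (`= expJacSU v` off the non-regular cone, `> 0` on `‖v‖ < π`), and the
# Jacobian `normDet (J ∘ T_v)` of the area formula
# (cell `pub-balaban`, sub-cell `t4`, spine estimate NE7c (node U5b); ROUND-2 crew `t4-ne7c-formalise-*`, row S3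
# «SM-L9 SU(N) chart» of `t4/b2b-balaban-t4-ne7c-p1/LEAVES-NE7c-P1.md` (trigger `t4/T4-NE7c-TRIGGER.json`, c5:
# optional and last — `SU(2)` is the row's certified instance), the (CH)₁ line for `N ≥ 3` (GAPS G-ne7cL04-1; route
# memo `HOME/b2b-balaban-t4-ne7c-formalise-leaf-09/g5/ROUTE-CH1-SUN.md`, STEP 2; journal `CLAIMS.log` l.10254); seat
# `b2b-balaban-t4-ne7c-formalise-leaf-09` (gen 6); file 2 of 2; tree target
# `Summits/QuantumFields/BalabanUV/T4Continuum/Support/`; ADDITIVE — imports file 1 `ShellMeasureDuhamelHadamardSUN`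
# (the algebraic Duhamel operator and its determinant) and two Mathlib leaves (`integral_exp_mul_complex`,
# `LinearMap.normDet`) and modifies nothing)

HONEST FRAMING.  Finite four-torus programme, rung (B)+1 only — NOT infinite volume, NOT a mass gap, NOT the Clay
problem, NOT summit progress.  Nothing of [Balaban 1983–89] is mentioned or asserted; NE7c NOT proved and not touched
(spine PROVED 0/9); the chart identity (CH)₁ for `N ≥ 3` (the displayed binder `hCH` of
`ShellMeasureRealizedSUN.slotAntiConcentration_realized_suN_expJac`) stays DISPLAYED — this file is STEP 2 of its line
(STEP 1 = the chart derivative, seat `leaf-08`, `CLAIMS.log` l.10111; (H)/(AF) = Haar as normalised Hausdorff measure +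
the area formula
`Literature.Analysis.Calculus.AreaFormulaHausdorff`, seat `leaf-10`, l.10221; the Lebesgue-nullity of the
non-regular cone is a further file).  [folklore] matrix calculus — one elementary integral `∫₀¹ e^{irφ} dr` and
finite-dimensional linear algebra —, 0 sorry, 0 citations, no `def … : Prop`, no definition at all: the chart operator
is NOT defined here (that is STEP 1's `ShellMeasureExpDuhamelSUN`); every statement quantifies over ANY real-linear
`T : E_N → E_N` CHARACTERISED by its generator-side action
  `hT : ∀ w, genSU (T w) = ∫ r in (0:ℝ)..1, exp (-(r • genSU v)) * genSU w * exp (r • genSU v)`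
— the Duhamel integral of `Literature.Analysis.Calculus.ExpDuhamel.fderiv_exp_apply_eq_exp_mul_integral` (integrand
shape verbatim, `Matrix.Norms.Frobenius` scope = STEP 1's `genSU_duhT_eq_integral` and (AF)'s inner product), so that
the
left-trivialised derivative of the chart `v ↦ exp (genSU v)` is `h ↦ exp (genSU v) · genSU (T h)`; such a `T` EXISTS
(`exists_chartOp`) and is unique (`genSU` is injective).

THE POINTS.
* §1 TRANSFER TO THE CHART (algebra): a real-linear `T` with `genSU (T h) = U (duhMat θ ⊙ (U* (genSU h) U)) U*` is
  `coordSU⁻¹ ∘ duhOp U θ ∘ coordSU`, so `det T = ∏_{i<j} sinc²((θ_j−θ_i)/2)` (`det_eq_prod_sinc_of_frame`, file 1's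
  `det_duhOp` + `LinearMap.det_conj`).
* §2 THE BRIDGE: under a unitary diagonalisation `H(v) = U·diag θ·U*` (S3 f4 `exists_conjDiag`),
  `exp (r • genSU v) = U·diag(e^{irθ})·U*` (`exp_smul_genSU`), the integrand is
  `e^{−rX} H e^{rX} = U·[e^{ir(θ_b−θ_a)} (U*HU)_ab]·U*` (`conj_exp_eq_frame`), and integrating entry by entry
  (`Matrix.entryLinearMap … |>.toContinuousLinearMap`, `ContinuousLinearMap.intervalIntegral_comp_comm`,
  `integral_exp_mul_complex`: `∫₀¹ e^{irφ} dr = Φ(φ)`, `integral_cexp_mul_I`)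
  **`∫₀¹ e^{−r·genSU v} H e^{r·genSU v} dr = U · (duhMat θ ⊙ (U* H U)) · U*`** (`integral_conj_exp_eq_frame`).
* §3 THE HEADLINE, for any `T` with `hT`: **`det T = ∏_{i<j} sinc²((θ_j−θ_i)/2)`** for EVERY diagonalisation
  (`det_eq_prod_sinc`; RHS token-identical with S3 f4 `expJacSU_eq_prod_sinc`), hence **`det T = expJacSU v`** off the
  non-regular cone (`det_eq_expJacSU_of_conjDiag`; diagonalisation-free `det_eq_expJacSU` under `Re disc H(v) ≠ 0` — ON
  the cone `expJacSU = 0` by `expJacSU_eq_zero` while `det T_0 = 1`, so the agreement is almost-everywhere, the cone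
  being Lebesgue-null), `det T ∈ [0, 1]` (`det_mem_Icc`), **`0 < det T` for `‖v‖ < π`** (`det_pos_of_norm_lt_pi`: all
  gaps `|θ_j − θ_i| ≤ 2‖v‖ < 2π`, `abs_eigen_le_norm`) — the INVERTIBILITY of the chart differential on the open
  `π`-ball that the area formula (injective `HasFDerivWithinAt` derivative) requires —, the area-formula currency
  **`normDet (J ∘ T) = ∏_{i<j} sinc²((θ_j−θ_i)/2)`** for ANY real-linear isometry `J : E_N →ₗᵢ V` (Mathlib
  `LinearMap.normDet_comp_of_finrank_eq`, `LinearIsometry.normDet_eq_one`, `normDet_eq_abs_det`;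
  `normDet_isometry_comp`), and NON-VACUITY `∃ T, hT` (`exists_chartOp`).

WHAT THIS DOES NOT DO.  It does not define the chart operator or differentiate the chart (STEP 1), does not touch
Hausdorff or Haar measure ((H)/(AF)), and does not prove the cone null; (CH)₁ for `N ≥ 3` stays displayed until all of
these are in the tree.  NE7c NOT proved.
HONEST DEPENDENCY (cell, verbatim): continuum YM on T⁴ ⇐ BetaPertH ∧ nine spine estimates (0/9 proved);
BetaPertH ⇐ (D1) ∧ (D4) ∧ CAP+tail; G-an2-4 gates asym, D1 and NE2/3/4.
(v1.1, gen 7, DOCFIX for the crew referee's DV-21: the HONEST DEPENDENCY sentence above added; STATUS NOTE: since v1 all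
of «these» ARE in the tree — STEP 1 `ShellMeasureExpDuhamelSUN`, the junction `ShellMeasureExpDuhamelDetChartSUN`, (H)
`ShellMeasureHaarHausdorffSUN`, the cone nullity `ShellMeasureRegularConeSUN`, and the assembly
`ShellMeasureExpHaarAreaSUN.haar_restrict_expBallSU` / `ShellMeasureExpHaarClosedBallSUN.haar_restrict_expBallSU_le` — so
(CH)₁ is a THEOREM for every `N ≥ 1`, `0 ≤ S ≤ π`; NE7c still NOT proved; no declaration changed — every theorem below is
v1's byte for byte.)
-/

noncomputable section

namespace Summit.QuantumFields.BalabanUV.T4Continuum.ShellMeasureExpDuhamelDetSUN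

open Matrix Finset MeasureTheory
open scoped ComplexConjugate
open Complex (I normSq)
open Literature.MathematicalPhysics.QuantumFieldTheory.Balaban1983to89
open T4AdjointCovarianceUnitary (lieSU mem_lieSU_iff)
open ShellMeasureVandermondeSUN ShellMeasureExpChartSUN ShellMeasureExpJacobianSUN ShellMeasureDuhamelHadamardSUN

variable {N : ℕ}

/-! ## §1 Transfer to the chart space -/

section Transfer

/-- **TRANSFER TO THE CHART**: a real-linear map of the chart space `E_N` whose generator-side action is the algebraic
Duhamel operator has determinant `∏_{i<j} sinc²((θ_j−θ_i)/2)`. [folklore] -/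
theorem det_eq_prod_sinc_of_frame {U : Matrix.unitaryGroup (Fin N) ℂ} {θ : Fin N → ℝ} (T : ChartSU N →ₗ[ℝ] ChartSU N)
    (hT : ∀ h, genSU (T h) =
      (U : Matrix (Fin N) (Fin N) ℂ) *
          hadL (duhMat θ) (star (U : Matrix (Fin N) (Fin N) ℂ) * genSU h * (U : Matrix (Fin N) (Fin N) ℂ)) *
        star (U : Matrix (Fin N) (Fin N) ℂ)) :
    LinearMap.det T = ∏ i : Fin N, ∏ j ∈ Ioi i, Real.sinc ((θ j - θ i) / 2) ^ 2 := by
  have hT' : T = (coordSU (N := N)).toLinearEquiv.symm.toLinearMap ∘ₗ duhOp U θ ∘ₗ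
      (coordSU (N := N)).toLinearEquiv.toLinearMap := by
    apply LinearMap.ext
    intro h
    simp only [LinearMap.comp_apply, LinearEquiv.coe_coe, LinearIsometryEquiv.coe_toLinearEquiv]
    apply (coordSU (N := N)).injective
    rw [LinearIsometryEquiv.coe_symm_toLinearEquiv, LinearIsometryEquiv.apply_symm_apply]
    apply Subtype.ext
    rw [coe_duhOp]
    exact hT h
  rw [hT']
  have h := LinearMap.det_conj (duhOp U θ) (coordSU (N := N)).toLinearEquiv.symm
  rw [LinearEquiv.symm_symm, det_duhOp] at h
  exact h

end Transfer

/-! ## §2 The bridge: the Duhamel integral `∫₀¹ e^{−rX} H e^{rX} dr` IS the algebraic Duhamel operator -/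

section Bridge

open scoped Matrix.Norms.Frobenius

/-- the scalar Duhamel integral `∫₀¹ e^{irφ} dr = Φ(φ)`. [folklore] -/
theorem integral_cexp_mul_I (φ : ℝ) : ∫ r in (0:ℝ)..1, Complex.exp (r * φ * I) = duhCoeff φ := by
  by_cases hφ : φ = 0
  · simp [hφ]
  · have hc : (φ : ℂ) * I ≠ 0 := mul_ne_zero (Complex.ofReal_ne_zero.mpr hφ) Complex.I_ne_zero
    have hfun : (fun r : ℝ => Complex.exp (r * φ * I)) = fun r : ℝ => Complex.exp ((φ * I) * r) := by
      funext r; ring_nf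
    rw [hfun, integral_exp_mul_complex hc, duhCoeff_of_ne_zero hφ]
    simp

variable {v : ChartSU N} {U : Matrix.unitaryGroup (Fin N) ℂ} {θ : Fin N → ℝ}

/-- `exp (r · genSU v) = U · diag(e^{irθ}) · U*` under a diagonalisation of `H(v)`. [folklore] -/
theorem exp_smul_genSU (h : herm v = conjDiag U fun k => (θ k : ℂ)) (r : ℝ) :
    NormedSpace.exp (r • genSU v) = conjDiag U fun k => Complex.exp ((r * θ k : ℝ) * I) := by
  have h1 : r • genSU v = genSU (r • v) := by
    rw [genSU_smul, RCLike.real_smul_eq_coe_smul (K := ℂ)]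
    rfl
  rw [h1]
  exact exp_genSU_eq_conjDiag (herm_smul_eq_conjDiag h r)

/-- sandwiching by two diagonalised matrices in the same frame. [folklore] -/
theorem conjDiag_mul_mul_conjDiag (U : Matrix.unitaryGroup (Fin N) ℂ) (α β : Fin N → ℂ) (H : Matrix (Fin N) (Fin N) ℂ) :
    conjDiag U α * H * conjDiag U β =
      (U : Matrix (Fin N) (Fin N) ℂ) *
          (diagonal α * (star (U : Matrix (Fin N) (Fin N) ℂ) * H * (U : Matrix (Fin N) (Fin N) ℂ)) * diagonal β) *
        star (U : Matrix (Fin N) (Fin N) ℂ) := by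
  simp only [conjDiag, Matrix.mul_assoc]

/-- entries of `diag α · M · diag β`. [folklore] -/
theorem diagonal_mul_mul_diagonal_apply (α β : Fin N → ℂ) (M : Matrix (Fin N) (Fin N) ℂ) (a b : Fin N) :
    (diagonal α * M * diagonal β) a b = α a * M a b * β b := by
  rw [mul_diagonal, diagonal_mul]

/-- THE INTEGRAND in the frame: `e^{−rX} H e^{rX} = U · [e^{ir(θ_b−θ_a)} (U*HU)_ab]_ab · U*`. [folklore] -/
theorem conj_exp_eq_frame (h : herm v = conjDiag U fun k => (θ k : ℂ)) (H : Matrix (Fin N) (Fin N) ℂ) (r : ℝ) :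
    NormedSpace.exp (-(r • genSU v)) * H * NormedSpace.exp (r • genSU v) =
      (U : Matrix (Fin N) (Fin N) ℂ) *
        of (fun a b =>
          Complex.exp (r * (θ b - θ a) * I) *
            (star (U : Matrix (Fin N) (Fin N) ℂ) * H * (U : Matrix (Fin N) (Fin N) ℂ)) a b) *
        star (U : Matrix (Fin N) (Fin N) ℂ) := by
  rw [← neg_smul, exp_smul_genSU h, exp_smul_genSU h, conjDiag_mul_mul_conjDiag]
  congr 2
  ext a b
  rw [diagonal_mul_mul_diagonal_apply, of_apply, mul_right_comm, ← Complex.exp_add]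
  congr 2
  push_cast
  ring

/-- **THE BRIDGE**: under a diagonalisation `H(v) = U·diag θ·U*`, for every `H`,
`∫₀¹ e^{−r·genSU v} H e^{r·genSU v} dr = U · (C ⊙ (U* H U)) · U*` with `C = duhMat θ` — the Duhamel integral of
`Literature.Analysis.Calculus.ExpDuhamel.fderiv_exp_apply_eq_exp_mul_integral` IS the algebraic Duhamel operator of §4
(integral in the `Matrix.Norms.Frobenius` scope of STEP 1's `ShellMeasureExpDuhamelSUN.genSU_duhT_eq_integral`, of
`lieSU`'s Hilbert–Schmidt norm and of (AF)'s Frobenius inner product). [folklore] -/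
theorem integral_conj_exp_eq_frame (h : herm v = conjDiag U fun k => (θ k : ℂ)) (H : Matrix (Fin N) (Fin N) ℂ) :
    ∫ r in (0:ℝ)..1, NormedSpace.exp (-(r • genSU v)) * H * NormedSpace.exp (r • genSU v) =
      (U : Matrix (Fin N) (Fin N) ℂ) *
          hadL (duhMat θ) (star (U : Matrix (Fin N) (Fin N) ℂ) * H * (U : Matrix (Fin N) (Fin N) ℂ)) *
        star (U : Matrix (Fin N) (Fin N) ℂ) := by
  set M : Matrix (Fin N) (Fin N) ℂ := star (U : Matrix (Fin N) (Fin N) ℂ) * H * (U : Matrix (Fin N) (Fin N) ℂ) with hM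
  set F : ℝ → Matrix (Fin N) (Fin N) ℂ := fun r => of fun a b => Complex.exp (r * (θ b - θ a) * I) * M a b with hF
  have hFc : Continuous F :=
    continuous_matrix fun a b => (Complex.continuous_exp.comp (by fun_prop)).mul continuous_const
  have hint : ∫ r in (0:ℝ)..1, F r = hadL (duhMat θ) M := by
    ext a b
    -- entry evaluation is a continuous linear map; it commutes with the integral (instance paths of the Frobenius
    -- scope are bridged by `Eq.trans`/`show`, i.e. definitionally, never by `rw`)
    have hE := ((Matrix.entryLinearMap ℝ ℂ a b).toContinuousLinearMap).intervalIntegral_comp_comm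
      (hFc.intervalIntegrable (μ := volume) 0 1)
    have h1 : (∫ r in (0:ℝ)..1, F r) a b =
        (Matrix.entryLinearMap ℝ ℂ a b).toContinuousLinearMap (∫ r in (0:ℝ)..1, F r) := rfl
    refine h1.trans (hE.symm.trans ?_)
    show (∫ r in (0:ℝ)..1, F r a b) = _
    simp only [hF, of_apply, hadL_apply, duhMat_apply]
    simp_rw [← Complex.ofReal_sub]
    rw [intervalIntegral.integral_mul_const, integral_cexp_mul_I]
  have hfun : (fun r : ℝ => NormedSpace.exp (-(r • genSU v)) * H * NormedSpace.exp (r • genSU v)) =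
      fun r => (ContinuousLinearMap.mulLeftRight ℝ (Matrix (Fin N) (Fin N) ℂ) (U : Matrix (Fin N) (Fin N) ℂ)
        (star (U : Matrix (Fin N) (Fin N) ℂ))) (F r) := by
    funext r
    rw [ContinuousLinearMap.mulLeftRight_apply, conj_exp_eq_frame h H r]
  rw [hfun]
  refine (ContinuousLinearMap.intervalIntegral_comp_comm _ (hFc.intervalIntegrable (μ := volume) 0 1)).trans ?_
  rw [ContinuousLinearMap.mulLeftRight_apply]
  exact congrArg (fun Z => (U : Matrix (Fin N) (Fin N) ℂ) * Z * star (U : Matrix (Fin N) (Fin N) ℂ)) hint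

end Bridge

/-! ## §3 The headline: the determinant of the Duhamel chart operator of `SU(N)` -/

section Headline

open scoped Matrix.Norms.Frobenius

variable {v : ChartSU N}

/-- **THE DETERMINANT OF THE DUHAMEL CHART OPERATOR OF `SU(N)`** (STEP 2 of the (CH)₁ line).  Let `T` be ANY
real-linear map of the chart space `E_N` whose generator-side action is the Duhamel integral of the chart point `v`,
`genSU (T w) = ∫₀¹ e^{−r·genSU v} (genSU w) e^{r·genSU v} dr` (the left-trivialised derivative of the exponential
chart, `Literature.Analysis.Calculus.ExpDuhamel.fderiv_exp_apply_eq_exp_mul_integral`).  Then, for EVERY unitary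
diagonalisation `H(v) = U·diag θ·U*` of the Hermitian generator,
`det T = ∏_{i<j} sinc²((θ_j − θ_i)/2)` — the RHS of `ShellMeasureExpJacobianSUN.expJacSU_eq_prod_sinc`. [folklore] -/
theorem det_eq_prod_sinc {U : Matrix.unitaryGroup (Fin N) ℂ} {θ : Fin N → ℝ}
    (h : herm v = conjDiag U fun k => (θ k : ℂ)) (T : ChartSU N →ₗ[ℝ] ChartSU N)
    (hT : ∀ w, genSU (T w) =
      ∫ r in (0:ℝ)..1, NormedSpace.exp (-(r • genSU v)) * genSU w * NormedSpace.exp (r • genSU v)) :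
    LinearMap.det T = ∏ i : Fin N, ∏ j ∈ Ioi i, Real.sinc ((θ j - θ i) / 2) ^ 2 :=
  det_eq_prod_sinc_of_frame T fun w => by rw [hT w, integral_conj_exp_eq_frame h]

/-- **… = THE EXPONENTIAL HAAR JACOBIAN `expJacSU v` OFF THE NON-REGULAR CONE** (under a diagonalisation with
`∏_{i<j}(θ_j − θ_i) ≠ 0`). [folklore] -/
theorem det_eq_expJacSU_of_conjDiag {U : Matrix.unitaryGroup (Fin N) ℂ} {θ : Fin N → ℝ}
    (h : herm v = conjDiag U fun k => (θ k : ℂ)) (hreg : ∏ i : Fin N, ∏ j ∈ Ioi i, (θ j - θ i) ≠ 0)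
    (T : ChartSU N →ₗ[ℝ] ChartSU N)
    (hT : ∀ w, genSU (T w) =
      ∫ r in (0:ℝ)..1, NormedSpace.exp (-(r • genSU v)) * genSU w * NormedSpace.exp (r • genSU v)) :
    LinearMap.det T = expJacSU v := by
  rw [det_eq_prod_sinc h T hT, expJacSU_eq_prod_sinc h hreg]

/-- **… DIAGONALISATION-FREE: `det T = expJacSU v` wherever the discriminant `Re disc H(v)` does not vanish** (the
complement of the closed non-regular cone; there `expJacSU = 0` by `expJacSU_eq_zero` while `det T_0 = 1`, so the
identity is an a.e. one — the cone's Lebesgue-nullity is a separate file). [folklore] -/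
theorem det_eq_expJacSU (hreg : (disc (herm v)).re ≠ 0) (T : ChartSU N →ₗ[ℝ] ChartSU N)
    (hT : ∀ w, genSU (T w) =
      ∫ r in (0:ℝ)..1, NormedSpace.exp (-(r • genSU v)) * genSU w * NormedSpace.exp (r • genSU v)) :
    LinearMap.det T = expJacSU v := by
  obtain ⟨U, θ, h⟩ := exists_conjDiag v
  rw [h, disc_conjDiag_re] at hreg
  exact det_eq_expJacSU_of_conjDiag h (fun h0 => hreg (by rw [h0, zero_pow two_ne_zero])) T hT

/-- `0 < sinc x` for `|x| < π`. [folklore] -/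
theorem sinc_pos_of_abs_lt_pi {x : ℝ} (hx : |x| < Real.pi) : 0 < Real.sinc x := by
  by_cases h0 : x = 0
  · rw [h0, Real.sinc_zero]; exact one_pos
  · rw [Real.sinc_of_ne_zero h0]
    rcases lt_or_gt_of_ne h0 with hneg | hpos
    · exact div_pos_of_neg_of_neg (Real.sin_neg_of_neg_of_neg_pi_lt hneg (abs_lt.mp hx).1) hneg
    · exact div_pos (Real.sin_pos_of_pos_of_lt_pi hpos (abs_lt.mp hx).2) hpos

/-- the root-space product is POSITIVE when all eigenvalue gaps are `< 2π`. [folklore] -/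
theorem prod_sinc_sq_pos {θ : Fin N → ℝ} (hgap : ∀ i j, |θ j - θ i| < 2 * Real.pi) :
    0 < ∏ i : Fin N, ∏ j ∈ Ioi i, Real.sinc ((θ j - θ i) / 2) ^ 2 :=
  prod_pos fun i _ => prod_pos fun j _ => pow_pos (sinc_pos_of_abs_lt_pi (by
    rw [abs_div, abs_two]; linarith [hgap i j])) 2

/-- the root-space product lies in `[0, 1]`. [folklore] -/
theorem prod_sinc_sq_mem_Icc (θ : Fin N → ℝ) :
    (∏ i : Fin N, ∏ j ∈ Ioi i, Real.sinc ((θ j - θ i) / 2) ^ 2) ∈ Set.Icc (0 : ℝ) 1 := by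
  refine ⟨prod_nonneg fun i _ => prod_nonneg fun j _ => sq_nonneg _, ?_⟩
  refine prod_le_one (fun i _ => prod_nonneg fun j _ => sq_nonneg _) fun i _ => ?_
  refine prod_le_one (fun j _ => sq_nonneg _) fun j _ => ?_
  rw [sq_le_one_iff_abs_le_one]
  exact Real.abs_sinc_le_one _

/-- eigenvalue gaps are at most twice the Hilbert–Schmidt norm of the chart point. [folklore] -/
theorem abs_sub_eigen_le {U : Matrix.unitaryGroup (Fin N) ℂ} {θ : Fin N → ℝ}
    (h : herm v = conjDiag U fun k => (θ k : ℂ)) (i j : Fin N) : |θ j - θ i| ≤ 2 * ‖v‖ :=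
  (abs_sub _ _).trans (by linarith [abs_eigen_le_norm h j, abs_eigen_le_norm h i])

/-- **THE DUHAMEL CHART OPERATOR IS INVERTIBLE ON THE OPEN `π`-BALL**: `0 < det T` for `‖v‖ < π` (all gaps
`|θ_j − θ_i| ≤ 2‖v‖ < 2π`) — the injectivity of the chart differential that the area formula requires. [folklore] -/
theorem det_pos_of_norm_lt_pi (hv : ‖v‖ < Real.pi) (T : ChartSU N →ₗ[ℝ] ChartSU N)
    (hT : ∀ w, genSU (T w) =
      ∫ r in (0:ℝ)..1, NormedSpace.exp (-(r • genSU v)) * genSU w * NormedSpace.exp (r • genSU v)) :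
    0 < LinearMap.det T := by
  obtain ⟨U, θ, h⟩ := exists_conjDiag v
  rw [det_eq_prod_sinc h T hT]
  exact prod_sinc_sq_pos fun i j => (abs_sub_eigen_le h i j).trans_lt (by linarith)

/-- `0 ≤ det T ≤ 1` everywhere. [folklore] -/
theorem det_mem_Icc (T : ChartSU N →ₗ[ℝ] ChartSU N)
    (hT : ∀ w, genSU (T w) =
      ∫ r in (0:ℝ)..1, NormedSpace.exp (-(r • genSU v)) * genSU w * NormedSpace.exp (r • genSU v)) :
    LinearMap.det T ∈ Set.Icc (0 : ℝ) 1 := by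
  obtain ⟨U, θ, h⟩ := exists_conjDiag v
  rw [det_eq_prod_sinc h T hT]
  exact prod_sinc_sq_mem_Icc θ

/-- **THE `d_N`-DIMENSIONAL JACOBIAN OF AN ISOMETRIC EMBEDDING AFTER THE DUHAMEL OPERATOR** (the currency of the area
formula
`Literature.Analysis.Calculus.AreaFormulaHausdorff`, Mathlib's `LinearMap.normDet`): for any real-linear isometry
`J : E_N →ₗᵢ V` into a real inner-product space, `normDet (J ∘ T) = det T = ∏_{i<j} sinc²((θ_j − θ_i)/2)`. [folklore] -/
theorem normDet_isometry_comp {V : Type*} [NormedAddCommGroup V] [InnerProductSpace ℝ V]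
    (J : ChartSU N →ₗᵢ[ℝ] V) {U : Matrix.unitaryGroup (Fin N) ℂ} {θ : Fin N → ℝ}
    (h : herm v = conjDiag U fun k => (θ k : ℂ)) (T : ChartSU N →ₗ[ℝ] ChartSU N)
    (hT : ∀ w, genSU (T w) =
      ∫ r in (0:ℝ)..1, NormedSpace.exp (-(r • genSU v)) * genSU w * NormedSpace.exp (r • genSU v)) :
    (J.toLinearMap ∘ₗ T).normDet = ∏ i : Fin N, ∏ j ∈ Ioi i, Real.sinc ((θ j - θ i) / 2) ^ 2 := by
  rw [LinearMap.normDet_comp_of_finrank_eq T J.toLinearMap rfl, LinearIsometry.normDet_eq_one, one_mul,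
    LinearMap.normDet_eq_abs_det, det_eq_prod_sinc h T hT, abs_of_nonneg (prod_sinc_sq_mem_Icc θ).1]

/-- **NON-VACUITY**: a real-linear `T` with the characterising property `hT` EXISTS (it is `coordSU⁻¹ ∘ duhOp U θ ∘
coordSU` for any diagonalisation — by the bridge, with NO closedness argument; it is unique since `genSU` is injective,
and it is STEP 1's chart operator). [folklore] -/
theorem exists_chartOp (v : ChartSU N) :
    ∃ T : ChartSU N →ₗ[ℝ] ChartSU N, ∀ w, genSU (T w) =
      ∫ r in (0:ℝ)..1, NormedSpace.exp (-(r • genSU v)) * genSU w * NormedSpace.exp (r • genSU v) := by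
  obtain ⟨U, θ, h⟩ := exists_conjDiag v
  refine ⟨(coordSU (N := N)).toLinearEquiv.symm.toLinearMap ∘ₗ duhOp U θ ∘ₗ
    (coordSU (N := N)).toLinearEquiv.toLinearMap, fun w => ?_⟩
  rw [integral_conj_exp_eq_frame h]
  simp only [LinearMap.comp_apply, LinearEquiv.coe_coe, LinearIsometryEquiv.coe_toLinearEquiv,
    LinearIsometryEquiv.coe_symm_toLinearEquiv]
  unfold genSU
  rw [LinearIsometryEquiv.apply_symm_apply, coe_duhOp]

end Headline

end Summit.QuantumFields.BalabanUV.T4Continuum.ShellMeasureExpDuhamelDetSUN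

end
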